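import Literature.InformationTheory.QuantumCodes.SyndromeDecodingHardness
import Literature.InformationTheory.QuantumCodes.QuantumDistanceNP
import HarnessLib

/-!
# COSET GENERALIZED WEIGHTS is in `NP`, hence NP-complete (Fujita 2012; Kuo–Lu 2020) — PROVED

Companion of `SyndromeDecodingHardness.lean` (the language `CGW` of quantum bounded-distance / minimum-weight
syndrome decoding and the KERNEL theorems `KuoLu2020_cosetGeneralizedWeights(Z)_isNPHard`). Kuo–Lu
[KuoLu2020, §3] print (restating [Fujita2012, Lemma 2]) «Theorem. CGW is NP-complete, even if
`H = [H_X|O]` or `H = [O|H_Z]`» (held text `paper:arxiv-1306.5173`, chunk p0005 L129–134). This file supplies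
the MEMBERSHIP half, so that the printed statement is a theorem of the tree:

* `SynDecNP.V` — the verifier, in the algebra of `FP` string bricks (no machine is written). On `⟨x, c⟩` with
  `c = ⟨a, b⟩` (the bits of an error `e = (a|b)`) it checks `T` (`x` is the canonical code
  `⟨⟨bin m, ⟨bin n, ⟨⟨1^m, rows⟩, s⟩⟩⟩, bin t⟩` of an instance: `x` equals the re-encoding of its own
  fields, `|s| = m`, and both parts of every row have length `n`) and then EITHER the row-free case
  (`m = 0`: always a yes-instance — the error `0` has the empty syndrome and weight `0 ≤ t` — decided
  without a certificate, since such codes carry `n` in binary only) OR, for `m ≥ 1`: the certificate shape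
  `|a| = |b| = n`, that the rows pairwise commute (`H Λ Hᵀ = O`, a double `allIdxFn` of symplectic
  parities), that the symplectic parity of `e` with row `i` equals the syndrome bit `sᵢ` for every `i`
  (`e Λ Hᵀ = s`), and that `gw(e) ≤ t` (a sum fold compared in binary);
* `SynDecNP.CGW_mem_NP : CGW ∈ NP` (certificate of length `≤ 3|x| + 2`), `SynDecNP.CGWZ_mem_NP : CGWZ ∈ NP`
  (same verifier plus the Z-type test `aᵢ = 0ⁿ` for every row);
* **`KuoLu2020_cosetGeneralizedWeights_isNPComplete : IsNPComplete CGW`** and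
  **`KuoLu2020_cosetGeneralizedWeightsZ_isNPComplete : IsNPComplete CGWZ`** — the printed theorem with its
  clause «even if `H = [O|H_Z]`», from the hardness halves of `SyndromeDecodingHardness.lean`.

## References

* [KuoLu2020] K.-Y. Kuo, C.-C. Lu, *On the hardnesses of several quantum decoding problems*, Quantum Inf.
  Process. 19 (2020) 123 = arXiv:1306.5173 (held: `paper:arxiv-1306.5173`): §2 (chunk p0004: `Λ`, `gw`),
  §3 (chunk p0005 L118–127 problem CGW; L129–134 Theorem «CGW is NP-complete, even if H = [H_X|O] or
  H = [O|H_Z]»; L135–150 CGW_Z).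
* [Fujita2012] H. Fujita, *Quantum McEliece public-key cryptosystem*, Quantum Inf. Comput. 12 (2012) 181–202,
  Lemma 2 — cited THROUGH Kuo–Lu's restatement (page not held).
* [AroraBarak2009] S. Arora, B. Barak, *Computational Complexity*, CUP 2009, Def. 2.1 (NP via certificates),
  §1.3, §0.1.

## Mathlib / tree search

`rg 'CGW|cosetGeneralizedWeights'` (2026-08-27): only `SyndromeDecodingHardness.lean`. Pattern and bricks
reused from `QuantumDistanceNP.lean` (`QMinDistNP.rOf/nOf/tOf/rhat/nhat/rhatF/nhatF` — the size fields sit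
at the same places in both codes —, `vecOf/svecOf/bitsOf`, the symplectic-parity bricks `spPar`, `bitK`,
`spInit`, `spNat`/`wtNat` and their semantics `spNat_cast`, `wtNat_eq_sympWeight`), `mem_P_of_mem_FP`.
-/

noncomputable section

namespace Literature.InformationTheory.QuantumCodes

open _root_.Computability Literature.Computability.Complexity Literature.InformationTheory.Coding
open scoped Literature.Computability.Complexity.Notation

namespace SynDecNP

open Polynomial Brick HashBricks Plumb
open QMinDistNP (rOf nOf tOf rhat nhat rhatF nhatF rnF nnF vecOf svecOf bitsOf spNat wtNat spPar bitK spInit lenOk)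

/-! ### Small facts -/

/-- A bit string is the table of its own bits. [folklore] -/
private theorem ofFn_getD {n : ℕ} {l : List Bool} (hl : l.length = n) :
    (List.ofFn fun j : Fin n => l.getD j false) = l := by
  subst hl
  apply List.ext_getElem (by simp)
  intro i h1 h2
  rw [List.getElem_ofFn, List.getD_eq_getElem]

/-- The framed body of a list code is the concatenation of one-item frames. [folklore] -/
private theorem frames_ofFn_eq_ccat (c : ℕ → List Bool) (n : ℕ) :
    frames (List.ofFn fun i : Fin n => c i) = ccat (fun i => boolPair (c i) []) n := by
  rw [frames_ofFn]
  exact ccat_congr fun i _ => by rw [boolPair_eq, List.append_nil]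

/-- `fstF` does not lengthen. [folklore] -/
private theorem length_fstF_le (z : List Bool) : (fstF z).length ≤ z.length := by
  have := length_fstF_sndF_le z; omega

/-- `sndF` does not lengthen. [folklore] -/
private theorem length_sndF_le (z : List Bool) : (sndF z).length ≤ z.length := by
  have := length_fstF_sndF_le z; omega

/-- The first piece is a part of the concatenation. [folklore] -/
private theorem length_le_length_ccat (g : ℕ → List Bool) {k : ℕ} (hk : 0 < k) : (g 0).length ≤ (ccat g k).length := by
  obtain ⟨k, rfl⟩ := Nat.exists_eq_add_of_le' hk
  induction k with
  | zero => simp [ccat]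
  | succ k ih => rw [ccat_succ, List.length_append]; exact (ih (Nat.succ_pos _)).trans (Nat.le_add_right _ _)

/-- Every element of `𝔽₂` is `0` or `1`. [folklore] -/
private theorem zmod2_cases (a : ZMod 2) : a = 0 ∨ a = 1 := by
  revert a; decide

/-- `rhat ≤ |x|`. [folklore] -/
private theorem rhat_le (x : List Bool) : rhat x ≤ x.length := Nat.min_le_right _ _

/-- `nhat ≤ |x|`. [folklore] -/
private theorem nhat_le (x : List Bool) : nhat x ≤ x.length := Nat.min_le_right _ _

/-- `1ᵃ = 1ᵇ ↔ a = b`. [folklore] -/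
private theorem decide_ones_eq_ones (a b : ℕ) : decide (ones a = ones b) = decide (a = b) :=
  decide_eq_decide.2 ⟨fun h => by simpa [ones] using congrArg List.length h, fun h => h ▸ rfl⟩

/-- `1ᵃ = ε ↔ a = 0`. [folklore] -/
private theorem decide_ones_eq_nil (a : ℕ) : decide (ones a = []) = decide (a = 0) := by
  cases a <;> simp [ones, List.replicate_succ]

/-- Residues mod `2` as elements of `𝔽₂` (re-proved; private upstream). [folklore] -/
private theorem natCast_eq_ite_iff (S : ℕ) (b : Bool) :
    ((S : ZMod 2) = if b = true then 1 else 0) ↔ decide (S % 2 = 1) = b := by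
  rw [← ZMod.natCast_mod S 2]
  have h := Nat.mod_lt S two_pos
  interval_cases hS : S % 2 <;> cases b <;> simp

/-- **The syndrome bit test in `𝔽₂`**: the symplectic inner product of two bit-table vectors equals the bit
`b` (as `0/1`) iff the accumulated pairing has parity `b`. [cite: KuoLu2020, §2 (Λ; chunk p0004 L96–110)] -/
theorem sympInner_svecOf_eq_bit_iff (p₁ p₂ q₁ q₂ : List Bool) (K : ℕ) (b : Bool) :
    (sympInner (svecOf K p₁ p₂) (svecOf K q₁ q₂) = if b = true then 1 else 0) ↔ decide (spNat p₁ p₂ q₁ q₂ K % 2 = 1) = b := by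
  rw [← QMinDistNP.spNat_cast, natCast_eq_ite_iff]

/-! ### Fields of an instance string `x = ⟨⟨bin m, ⟨bin n, ⟨⟨1^m, R⟩, s⟩⟩⟩, bin t⟩`

The size fields `m` (`QMinDistNP.rOf`), `n` (`nOf`), `t` (`tOf`) and their clamps `rhat`, `nhat` sit where
they sit in a `QMINDIST` code and are reused; the framed rows `R` and the syndrome `s` are new. -/

/-- The third field `⟨⟨1^m, R⟩, s⟩`. [folklore] -/
def X3 (x : List Bool) : List Bool := sndF (sndF (fstF x))
/-- The framed rows `R`. [folklore] -/
def ROf (x : List Bool) : List Bool := sndF (fstF (X3 x))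
/-- The syndrome bits `s`. [cite: KuoLu2020, §3 (problem CGW, Input s; chunk p0005 L118–124)] -/
def SOf (x : List Bool) : List Bool := sndF (X3 x)
/-- Row `i` of `R` (the pair code `⟨aᵢ, bᵢ⟩`; junk past the end). [folklore] -/
def item (x : List Bool) (i : ℕ) : List Bool := fstF (sndF^[i] (ROf x))
/-- The X-part bits `aᵢ` of row `i`. [cite: KuoLu2020, §2 (rows (x|z) of H; chunk p0004 L111–118)] -/
def aIt (x : List Bool) (i : ℕ) : List Bool := fstF (item x i)
/-- The Z-part bits `bᵢ` of row `i`. [cite: KuoLu2020, §2 (rows (x|z) of H; chunk p0004 L111–118)] -/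
def bIt (x : List Bool) (i : ℕ) : List Bool := sndF (item x i)

/-- The rows read off `x`. [cite: KuoLu2020, §2 (check matrix H; chunk p0004 L111–118)] -/
def rowsOf (x : List Bool) : Fin (rOf x) → SympVec (nOf x) := fun i => svecOf (nOf x) (aIt x i) (bIt x i)
/-- The syndrome read off `x`. [cite: KuoLu2020, §3 (Input s; chunk p0005 L118–124)] -/
def sVecOf (x : List Bool) : Fin (rOf x) → ZMod 2 := vecOf (rOf x) (SOf x)
/-- The instance read off `x`. [cite: KuoLu2020, §3 (problem CGW; chunk p0005 L118–127)] -/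
def instOf (x : List Bool) : (Σ m : ℕ, Σ n : ℕ, (Fin m → SympVec n) × (Fin m → ZMod 2)) × ℕ :=
  (⟨rOf x, nOf x, (rowsOf x, sVecOf x)⟩, tOf x)

/-- **The re-encoding of the fields of `x`** (with the clamped `m`). [cite: AroraBarak2009, §0.1] -/
def reb (x : List Bool) : List Bool :=
  boolPair (boolPair (encodeNat (rOf x)) (boolPair (encodeNat (nOf x))
    (boolPair (boolPair (ones (rhat x)) (ccat (fun i => boolPair (boolPair (aIt x i) (bIt x i)) []) (rhat x))) (SOf x))))
    (encodeNat (tOf x))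

/-- **`x` is the canonical code of an instance**: it equals its own re-encoding, `|s| = m`, and both parts of
every row have length `n`. [cite: AroraBarak2009, §0.1] -/
def GoodShape (x : List Bool) : Prop :=
  x = reb x ∧ (SOf x).length = rhat x ∧ ∀ i < rhat x, (aIt x i).length = nhat x ∧ (bIt x i).length = nhat x

/-- Rows are parts of `x`. [folklore] -/
private theorem length_item_le (x : List Bool) (i : ℕ) : (item x i).length ≤ x.length := by
  unfold item ROf X3
  refine (length_fstF_le _).trans ((length_sndF_iterate_le i _).trans ?_)
  exact (length_sndF_le _).trans ((length_fstF_le _).trans ((length_sndF_le _).trans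
    ((length_sndF_le _).trans (length_fstF_le _))))

/-- X-parts are parts of `x`. [folklore] -/
private theorem length_aIt_le (x : List Bool) (i : ℕ) : (aIt x i).length ≤ x.length :=
  (length_fstF_le _).trans (length_item_le x i)

/-- Z-parts are parts of `x`. [folklore] -/
private theorem length_bIt_le (x : List Bool) (i : ℕ) : (bIt x i).length ≤ x.length :=
  (length_sndF_le _).trans (length_item_le x i)

/-- The syndrome is a part of `x`. [folklore] -/
private theorem length_SOf_le (x : List Bool) : (SOf x).length ≤ x.length := by
  unfold SOf X3
  exact (length_sndF_le _).trans ((length_sndF_le _).trans ((length_sndF_le _).trans (length_fstF_le _)))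

/-- **On a good shape the clamps are off**: `rhat = m`, and `nhat = n` as soon as there is a row.
[cite: AroraBarak2009, §0.1 (representing objects as strings)] -/
theorem clamps_of_goodShape {x : List Bool} (h : GoodShape x) : rhat x = rOf x ∧ (0 < rhat x → nhat x = nOf x) := by
  obtain ⟨hx, -, hrows⟩ := h
  have hlen := congrArg List.length hx
  simp only [reb, length_boolPair, List.length_replicate] at hlen
  refine ⟨by unfold QMinDistNP.rhat at *; omega, fun hr => ?_⟩
  have h0 := (hrows 0 hr).1
  have hc := length_le_length_ccat (fun i => boolPair (boolPair (aIt x i) (bIt x i)) []) hr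
  simp only [length_boolPair, List.length_nil] at hc
  unfold QMinDistNP.nhat at *
  omega

/-- **A good-shaped string is the code of the instance read off it.** [cite: AroraBarak2009, §0.1] -/
theorem encode_instOf {x : List Bool} (h : GoodShape x) :
    (encodingSyndInstance.pairBool encodingNatBool).encode (instOf x) = x := by
  obtain ⟨hr, hn⟩ := clamps_of_goodShape h
  obtain ⟨hx, hs, hrows⟩ := h
  conv_rhs => rw [hx]
  show boolPair (boolPair (encodeNat (rOf x)) (boolPair (encodeNat (nOf x)) (boolPair
    ((encodingFinVec ((encodingF2Vec (nOf x)).pairBool (encodingF2Vec (nOf x))) (rOf x)).encode (rowsOf x))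
    ((encodingF2Vec (rOf x)).encode (sVecOf x))))) (encodeNat (tOf x)) = _
  rw [reb, finVec_encode_eq, ← boolPair_eq, OracleCompose.unaryEncodeNat_eq_replicate, hr, ← frames_ofFn_eq_ccat, sVecOf,
    QMinDistNP.encode_vecOf, ofFn_getD (by rw [hs, hr])]
  congr 6
  refine List.ofFn_inj.2 (funext fun i => ?_)
  have hi : (i : ℕ) < rhat x := by rw [hr]; exact i.2
  obtain ⟨ha, hb⟩ := hrows i hi
  rw [hn (by omega)] at ha hb
  show boolPair ((encodingF2Vec (nOf x)).encode (vecOf (nOf x) (aIt x i))) ((encodingF2Vec (nOf x)).encode (vecOf (nOf x) (bIt x i))) = _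
  rw [QMinDistNP.encode_vecOf, QMinDistNP.encode_vecOf, ofFn_getD ha, ofFn_getD hb]

/-! ### Codes of instances are good-shaped -/

section Code

variable (I : (Σ m : ℕ, Σ n : ℕ, (Fin m → SympVec n) × (Fin m → ZMod 2)) × ℕ)

/-- The code of row `i` as a function on `ℕ` (junk `[]` past the end). [cite: AroraBarak2009, §0.1] -/
def rowCode (i : ℕ) : List Bool :=
  (List.ofFn fun i : Fin I.1.1 => ((encodingF2Vec I.1.2.1).pairBool (encodingF2Vec I.1.2.1)).encode (I.1.2.2.1 i)).getD i []

/-- The code of an instance, spelled out. [cite: AroraBarak2009, §0.1] -/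
theorem encode_eq :
    (encodingSyndInstance.pairBool encodingNatBool).encode I =
      boolPair (boolPair (encodeNat I.1.1) (boolPair (encodeNat I.1.2.1)
        (boolPair (boolPair (ones I.1.1) (ccat (fun t => boolPair (rowCode I t) []) I.1.1)) (bitsOf I.1.2.2.2))))
        (encodeNat I.2) := by
  obtain ⟨⟨r, n, rows, s⟩, t⟩ := I
  show boolPair (boolPair (encodeNat r) (boolPair (encodeNat n) (boolPair
    ((encodingFinVec ((encodingF2Vec n).pairBool (encodingF2Vec n)) r).encode rows) ((encodingF2Vec r).encode s))))
    (encodeNat t) = _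
  rw [finVec_encode_eq, ← boolPair_eq, OracleCompose.unaryEncodeNat_eq_replicate, ← frames_ofFn_eq_ccat,
    QMinDistNP.encode_eq_bitsOf]
  congr 6
  refine List.ofFn_inj.2 (funext fun i => ?_)
  rw [rowCode, List.getD_eq_getElem _ _ (by simp), List.getElem_ofFn]

/-- The fields of a code. [cite: AroraBarak2009, §0.1] -/
theorem fields_encode :
    rOf ((encodingSyndInstance.pairBool encodingNatBool).encode I) = I.1.1 ∧
    nOf ((encodingSyndInstance.pairBool encodingNatBool).encode I) = I.1.2.1 ∧
    tOf ((encodingSyndInstance.pairBool encodingNatBool).encode I) = I.2 ∧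
    ROf ((encodingSyndInstance.pairBool encodingNatBool).encode I) = ccat (fun t => boolPair (rowCode I t) []) I.1.1 ∧
    SOf ((encodingSyndInstance.pairBool encodingNatBool).encode I) = bitsOf I.1.2.2.2 := by
  simp only [QMinDistNP.rOf, QMinDistNP.nOf, QMinDistNP.tOf, ROf, SOf, X3, encode_eq, fstF_boolPair, sndF_boolPair,
    bitsToNat_encodeNat, and_self]

/-- The rows of a code. [cite: AroraBarak2009, §0.1] -/
theorem item_encode (t : ℕ) : item ((encodingSyndInstance.pairBool encodingNatBool).encode I) t = rowCode I t := by
  rw [item, (fields_encode I).2.2.2.1, ccat_frame_eq_encList, sndF_iterate_encList, fstF_encList]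
  by_cases ht : t < I.1.1
  · have h1 : ((List.range I.1.1).map (rowCode I)).drop t = rowCode I t :: ((List.range I.1.1).map (rowCode I)).drop (t + 1) := by
      rw [← List.getElem_cons_drop (by simpa using ht)]
      simp
    rw [h1, List.headD_cons]
  · rw [List.drop_eq_nil_of_le (by simpa using Nat.le_of_not_lt ht), List.headD_nil, rowCode,
      List.getD_eq_default _ _ (by rw [List.length_ofFn]; exact Nat.le_of_not_lt ht)]

/-- The code of a row in range. [cite: AroraBarak2009, §0.1] -/
theorem rowCode_of_lt (i : Fin I.1.1) :
    rowCode I i = boolPair ((encodingF2Vec I.1.2.1).encode (I.1.2.2.1 i).1) ((encodingF2Vec I.1.2.1).encode (I.1.2.2.1 i).2) := by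
  rw [rowCode, List.getD_eq_getElem _ _ (by simp), List.getElem_ofFn]
  rfl

/-- Length of a vector code. [folklore] -/
private theorem length_encode_vec {n : ℕ} (v : Fin n → ZMod 2) : ((encodingF2Vec n).encode v).length = n := by
  show (List.ofFn _).length = _; rw [List.length_ofFn]

/-- `m ≤ |code|`. [folklore] -/
private theorem r_le_length_encode : I.1.1 ≤ ((encodingSyndInstance.pairBool encodingNatBool).encode I).length := by
  rw [encode_eq]; simp only [length_boolPair, List.length_replicate]; omega

/-- `n ≤ |code|` when there is a row. [folklore] -/
private theorem n_le_length_encode (hr : 0 < I.1.1) : I.1.2.1 ≤ ((encodingSyndInstance.pairBool encodingNatBool).encode I).length := by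
  have hc := length_le_length_ccat (fun t => boolPair (rowCode I t) []) hr
  have h0 : rowCode I 0 = rowCode I ((⟨0, hr⟩ : Fin I.1.1) : ℕ) := rfl
  rw [h0, rowCode_of_lt] at hc
  simp only [length_boolPair, List.length_nil, length_encode_vec] at hc
  rw [encode_eq]; simp only [length_boolPair, List.length_replicate]; omega

/-- The clamps on a code. [cite: AroraBarak2009, §0.1 (representing objects as strings)] -/
theorem clamps_encode :
    rhat ((encodingSyndInstance.pairBool encodingNatBool).encode I) = I.1.1 ∧
    (0 < I.1.1 → nhat ((encodingSyndInstance.pairBool encodingNatBool).encode I) = I.1.2.1) := by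
  refine ⟨?_, fun hr => ?_⟩
  · rw [QMinDistNP.rhat, (fields_encode I).1, Nat.min_eq_left (r_le_length_encode I)]
  · rw [QMinDistNP.nhat, (fields_encode I).2.1, Nat.min_eq_left (n_le_length_encode I hr)]

/-- **Codes are good-shaped.** [cite: AroraBarak2009, §0.1] -/
theorem goodShape_encode : GoodShape ((encodingSyndInstance.pairBool encodingNatBool).encode I) := by
  obtain ⟨hm, hn⟩ := clamps_encode I
  obtain ⟨h1, h2, h3, h4, h5⟩ := fields_encode I
  refine ⟨?_, by rw [h5, QMinDistNP.length_bitsOf, hm], fun t ht => ?_⟩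
  · have hc : ccat (fun t => boolPair (boolPair (aIt ((encodingSyndInstance.pairBool encodingNatBool).encode I) t)
        (bIt ((encodingSyndInstance.pairBool encodingNatBool).encode I) t)) []) I.1.1 = ccat (fun t => boolPair (rowCode I t) []) I.1.1 :=
      ccat_congr fun t ht => by
        rw [aIt, bIt, item_encode, rowCode_of_lt I ⟨t, ht⟩, fstF_boolPair, sndF_boolPair]
    rw [reb, h1, h2, h3, h5, hm, hc, ← encode_eq]
  · rw [hm] at ht
    rw [hn (by omega), aIt, bIt, item_encode, rowCode_of_lt I ⟨t, ht⟩, fstF_boolPair, sndF_boolPair, length_encode_vec,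
      length_encode_vec]
    exact ⟨rfl, rfl⟩

/-- Rows of a code read back as symplectic vectors. [cite: KuoLu2020, §2 (rows of H; chunk p0004 L111–118)] -/
theorem svecOf_aIt_bIt (i : Fin I.1.1) :
    svecOf I.1.2.1 (aIt ((encodingSyndInstance.pairBool encodingNatBool).encode I) i)
      (bIt ((encodingSyndInstance.pairBool encodingNatBool).encode I) i) = I.1.2.2.1 i := by
  rw [aIt, bIt, item_encode, rowCode_of_lt, fstF_boolPair, sndF_boolPair, QMinDistNP.encode_eq_bitsOf,
    QMinDistNP.encode_eq_bitsOf, QMinDistNP.svecOf_bitsOf]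

/-- Syndrome bits of a code read back. [cite: KuoLu2020, §3 (Input s; chunk p0005 L118–124)] -/
theorem getD_SOf_encode (i : Fin I.1.1) :
    (SOf ((encodingSyndInstance.pairBool encodingNatBool).encode I)).getD i false = decide (I.1.2.2.2 i = 1) := by
  rw [(fields_encode I).2.2.2.2, QMinDistNP.bitsOf, List.getD_eq_getElem _ _ (by simp), List.getElem_ofFn]

end Code

/-! ### The instance test `T` (bricks) -/

/-- On `x`: the framed rows `R`. [folklore] -/
def RF : List Bool → List Bool := sndF ∘ fstF ∘ sndF ∘ sndF ∘ fstF
/-- On `x`: the syndrome bits `s`. [folklore] -/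
def SF : List Bool → List Bool := sndF ∘ sndF ∘ sndF ∘ fstF
/-- On `⟨x, 1ⁱ⟩`: row `i`. [folklore] -/
def itemF : List Bool → List Bool := nthItemFn ∘ fanoutFn sndF (RF ∘ fstF)
/-- On `⟨x, 1ⁱ⟩`: the framed row `⟨⟨aᵢ, bᵢ⟩, ε⟩`. [folklore] -/
def rowPieceF : List Bool → List Bool := fanoutFn (fanoutFn (fstF ∘ itemF) (sndF ∘ itemF)) (fun _ => [])
/-- On `x`: the re-listed rows (concatenation fold over `i < rhat`). [cite: AroraBarak2009, §1.3 (bounded loops)] -/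
def rrebF : List Bool → List Bool := foldCat (6 * X + 6) X rowPieceF ∘ fanoutFn id rhatF
/-- On `x`: **the re-encoding** `reb x`. [cite: AroraBarak2009, §0.1] -/
def rebF : List Bool → List Bool :=
  fanoutFn (fanoutFn (norm ∘ rnF) (fanoutFn (norm ∘ nnF) (fanoutFn (fanoutFn rhatF rrebF) SF))) (norm ∘ sndF)
/-- On `x`: `[x = reb x]`. [folklore] -/
def t0 : List Bool → List Bool := eqPairFn ∘ fanoutFn id rebF
/-- On `x`: `[|s| = rhat]`. [folklore] -/
def t1 : List Bool → List Bool := eqPairFn ∘ fanoutFn (onesFn ∘ SF) rhatF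
/-- On `⟨x, 1ⁱ⟩`: `[|aᵢ| = nhat ∧ |bᵢ| = nhat]`. [folklore] -/
def cLen : List Bool → List Bool :=
  andFn (eqPairFn ∘ fanoutFn (onesFn ∘ fstF ∘ itemF) (nhatF ∘ fstF)) (eqPairFn ∘ fanoutFn (onesFn ∘ sndF ∘ itemF) (nhatF ∘ fstF))
/-- On `x`: all rows have parts of length `nhat`. [folklore] -/
def t2 : List Bool → List Bool := allIdxFn rhatF cLen
/-- **The instance test** on `x`. [cite: AroraBarak2009, §0.1] -/
def T : List Bool → List Bool := andFn t0 (andFn t1 t2)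

/-- `RF ∈ FP`. [cite: AroraBarak2009, §1.3 (polynomial time is closed under composition)] -/
theorem RF_mem_FP : RF ∈ FP :=
  comp_mem_FP sndF_mem_FP (comp_mem_FP fstF_mem_FP (comp_mem_FP sndF_mem_FP (comp_mem_FP sndF_mem_FP fstF_mem_FP)))

/-- `SF ∈ FP`. [cite: AroraBarak2009, §1.3 (polynomial time is closed under composition)] -/
theorem SF_mem_FP : SF ∈ FP :=
  comp_mem_FP sndF_mem_FP (comp_mem_FP sndF_mem_FP (comp_mem_FP sndF_mem_FP fstF_mem_FP))

/-- `itemF ∈ FP`. [cite: AroraBarak2009, §1.3 (polynomial time is closed under composition)] -/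
theorem itemF_mem_FP : itemF ∈ FP :=
  comp_mem_FP nthItemFn_mem_FP (fanoutFn_mem_FP sndF_mem_FP (comp_mem_FP RF_mem_FP fstF_mem_FP))

/-- `rowPieceF ∈ FP`. [cite: AroraBarak2009, §1.3 (polynomial time is closed under composition)] -/
theorem rowPieceF_mem_FP : rowPieceF ∈ FP :=
  fanoutFn_mem_FP (fanoutFn_mem_FP (comp_mem_FP fstF_mem_FP itemF_mem_FP) (comp_mem_FP sndF_mem_FP itemF_mem_FP)) (const_mem_FP _)

/-- `rebF ∈ FP`. [cite: AroraBarak2009, §1.3 (polynomial time is closed under composition and bounded loops)] -/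
theorem rebF_mem_FP : rebF ∈ FP := by
  have hr : rrebF ∈ FP :=
    comp_mem_FP (foldCat_mem_FP _ _ rowPieceF_mem_FP) (fanoutFn_mem_FP OracleCompose.id_mem_FP QMinDistNP.rhatF_mem_FP)
  exact fanoutFn_mem_FP (fanoutFn_mem_FP (comp_mem_FP norm_mem_FP (comp_mem_FP fstF_mem_FP fstF_mem_FP))
    (fanoutFn_mem_FP (comp_mem_FP norm_mem_FP (comp_mem_FP fstF_mem_FP (comp_mem_FP sndF_mem_FP fstF_mem_FP)))
      (fanoutFn_mem_FP (fanoutFn_mem_FP QMinDistNP.rhatF_mem_FP hr) SF_mem_FP))) (comp_mem_FP norm_mem_FP sndF_mem_FP)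

/-- `t1 ∈ FP`. [cite: AroraBarak2009, §1.3 (polynomial time is closed under composition)] -/
theorem t1_mem_FP : t1 ∈ FP :=
  comp_mem_FP eqPairFn_mem_FP (fanoutFn_mem_FP (comp_mem_FP onesFn_mem_FP SF_mem_FP) QMinDistNP.rhatF_mem_FP)

/-- `cLen ∈ FP`. [cite: AroraBarak2009, §1.3 (polynomial time is closed under composition)] -/
theorem cLen_mem_FP : cLen ∈ FP :=
  andFn_mem_FP (comp_mem_FP eqPairFn_mem_FP (fanoutFn_mem_FP (comp_mem_FP onesFn_mem_FP (comp_mem_FP fstF_mem_FP itemF_mem_FP))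
      (comp_mem_FP QMinDistNP.nhatF_mem_FP fstF_mem_FP)))
    (comp_mem_FP eqPairFn_mem_FP (fanoutFn_mem_FP (comp_mem_FP onesFn_mem_FP (comp_mem_FP sndF_mem_FP itemF_mem_FP))
      (comp_mem_FP QMinDistNP.nhatF_mem_FP fstF_mem_FP)))

/-- `cLen` is one-bit. [cite: AroraBarak2009, §1.3 (polynomial time is closed under composition)] -/
theorem oneBit_cLen : OneBit cLen := oneBit_andFn (oneBit_eqPairFn.comp _) (oneBit_eqPairFn.comp _)

/-- **`T ∈ FP`.** [cite: AroraBarak2009, §1.3 (polynomial time is closed under composition and bounded loops)] -/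
theorem T_mem_FP : T ∈ FP :=
  andFn_mem_FP (comp_mem_FP eqPairFn_mem_FP (fanoutFn_mem_FP OracleCompose.id_mem_FP rebF_mem_FP))
    (andFn_mem_FP t1_mem_FP (allIdxFn_mem_FP QMinDistNP.rhatF_mem_FP cLen_mem_FP oneBit_cLen))

/-- Value of `itemF`. [cite: AroraBarak2009, §1.3 (loops)] -/
theorem itemF_apply (x : List Bool) (i : ℕ) : itemF (boolPair x (ones i)) = item x i := by
  rw [itemF, Function.comp_apply, fanoutFn_apply, sndF_boolPair, Function.comp_apply, fstF_boolPair, nthItemFn_boolPair,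
    List.length_replicate]; rfl

/-- Value of `SF`. [cite: AroraBarak2009, §0.1 (pairing of strings)] -/
theorem SF_apply (x : List Bool) : SF x = SOf x := rfl

/-- `t1` is one-bit. [cite: AroraBarak2009, §1.3 (polynomial time is closed under composition)] -/
theorem oneBit_t1 : OneBit t1 := oneBit_eqPairFn.comp _

/-- `T` is one-bit. [cite: AroraBarak2009, §1.3 (polynomial time is closed under composition)] -/
theorem oneBit_T : OneBit T := by
  refine oneBit_andFn (oneBit_eqPairFn.comp _) (oneBit_andFn oneBit_t1 (oneBit_allIdxFn oneBit_cLen fun u => ?_))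
  rw [QMinDistNP.rhatF_apply, List.length_replicate]
  exact rhat_le u

/-- Value of `rowPieceF`. [folklore] -/
private theorem rowPieceF_apply (x : List Bool) (i : ℕ) :
    rowPieceF (boolPair x (ones i)) = boolPair (boolPair (aIt x i) (bIt x i)) [] := by
  rw [rowPieceF, fanoutFn_apply, fanoutFn_apply, Function.comp_apply, Function.comp_apply, itemF_apply]; rfl

/-- Value of `rebF`. [folklore] -/
private theorem rebF_apply (x : List Bool) : rebF x = reb x := by
  have hr : rrebF x = ccat (fun i => boolPair (boolPair (aIt x i) (bIt x i)) []) (rhat x) := by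
    rw [rrebF, Function.comp_apply, fanoutFn_apply, QMinDistNP.rhatF_apply, id,
      foldCat_apply (by rw [List.length_replicate, eval_X]; exact rhat_le x)
        (fun i _ => by
          rw [rowPieceF_apply, length_boolPair, length_boolPair, List.length_nil]
          simp only [eval_add, eval_mul, eval_ofNat, eval_X]
          have := length_aIt_le x i; have := length_bIt_le x i; omega), List.length_replicate]
    exact ccat_congr fun i _ => by rw [rowPieceF_apply]
  simp only [rebF, fanoutFn_apply, Function.comp_apply, norm_eq_encodeNat, QMinDistNP.rhatF_apply, hr, reb, SF_apply,
    QMinDistNP.rnF, QMinDistNP.nnF, QMinDistNP.rOf, QMinDistNP.nOf, QMinDistNP.tOf]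

/-- Value of `t1`. [folklore] -/
private theorem t1_apply (x : List Bool) : t1 x = [decide ((SOf x).length = rhat x)] := by
  rw [t1, Function.comp_apply, fanoutFn_apply, Function.comp_apply, SF_apply, ThreeDMNP.onesFn_eq_ones, QMinDistNP.rhatF_apply,
    eqPairFn_boolPair, decide_ones_eq_ones]

/-- Value of `cLen`. [folklore] -/
private theorem cLen_apply (x : List Bool) (i : ℕ) :
    cLen (boolPair x (ones i)) = [decide ((aIt x i).length = nhat x) && decide ((bIt x i).length = nhat x)] := by
  have h1 : (eqPairFn ∘ fanoutFn (onesFn ∘ fstF ∘ itemF) (nhatF ∘ fstF)) (boolPair x (ones i)) =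
      [decide ((aIt x i).length = nhat x)] := by
    rw [Function.comp_apply, fanoutFn_apply, Function.comp_apply, Function.comp_apply, itemF_apply, ThreeDMNP.onesFn_eq_ones,
      Function.comp_apply, fstF_boolPair, QMinDistNP.nhatF_apply, eqPairFn_boolPair, decide_ones_eq_ones, aIt]
  have h2 : (eqPairFn ∘ fanoutFn (onesFn ∘ sndF ∘ itemF) (nhatF ∘ fstF)) (boolPair x (ones i)) =
      [decide ((bIt x i).length = nhat x)] := by
    rw [Function.comp_apply, fanoutFn_apply, Function.comp_apply, Function.comp_apply, itemF_apply, ThreeDMNP.onesFn_eq_ones,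
      Function.comp_apply, fstF_boolPair, QMinDistNP.nhatF_apply, eqPairFn_boolPair, decide_ones_eq_ones, bIt]
  rw [cLen, andFn_apply h1 h2]

/-- **Truth of the instance test.** [cite: AroraBarak2009, §0.1] -/
theorem T_eq_true_iff (x : List Bool) : T x = [true] ↔ GoodShape x := by
  have h0 : t0 x = [decide (x = reb x)] := by
    rw [t0, Function.comp_apply, fanoutFn_apply, rebF_apply, eqPairFn_boolPair]; rfl
  have h2 : t2 x = [decide (∀ i < rhat x, (aIt x i).length = nhat x ∧ (bIt x i).length = nhat x)] := by
    rw [t2, allIdxFn_apply oneBit_cLen (h := rhatF) (by rw [QMinDistNP.rhatF_apply, List.length_replicate]; exact rhat_le x),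
      QMinDistNP.rhatF_apply, List.length_replicate]
    simp [cLen_apply]
  rw [T, andFn_apply h0 (andFn_apply (t1_apply x) h2), GoodShape]
  simp [Bool.and_eq_true, decide_eq_true_eq]

/-! ### The verifier (bricks) on `u = ⟨x, ⟨a, b⟩⟩` -/

/-- On `u`: the certificate shape `|a| = |b| = nhat`. [folklore] -/
def W1 : List Bool → List Bool := andFn (lenOk (fstF ∘ sndF)) (lenOk (sndF ∘ sndF))
/-- On `u`: the row-free case `m = 0` (always a yes-instance). [cite: KuoLu2020, §3 (problem CGW; chunk p0005 L118–127)] -/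
def Z0 : List Bool → List Bool := eqPairFn ∘ fanoutFn (rhatF ∘ fstF) (fun _ => [])
/-- On `u`: `[m ≠ 0]`. [folklore] -/
def R1 : List Bool → List Bool := notFn Z0
/-- On `⟨⟨u, 1ⁱ⟩, 1ʲ⟩`: `[row i commutes with row j]`. [cite: KuoLu2020, §3 (Input «H satisfying HΛHᵀ = O»; chunk p0005 L118–121)] -/
def soBit : List Bool → List Bool :=
  notFn (spPar (fstF ∘ fstF ∘ fstF) (itemF ∘ fanoutFn (fstF ∘ fstF ∘ fstF) (sndF ∘ fstF))
    (itemF ∘ fanoutFn (fstF ∘ fstF ∘ fstF) sndF))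
/-- On `u`: all pairs of rows commute (`H Λ Hᵀ = O`). [cite: KuoLu2020, §3 (Input; chunk p0005 L118–121)] -/
def SO : List Bool → List Bool := allIdxFn (rhatF ∘ fstF) (allIdxFn (rhatF ∘ fstF ∘ fstF) soBit)
/-- On `⟨u, 1ⁱ⟩`: `[(row i, e) = sᵢ]` — the `i`-th syndrome equation `(e Λ Hᵀ)ᵢ = sᵢ`.
[cite: KuoLu2020, §3 (Question «e Λ Hᵀ = s»; chunk p0005 L125–127)] -/
def syBit : List Bool → List Bool :=
  notFn (xorFn (spPar (fstF ∘ fstF) (itemF ∘ fanoutFn (fstF ∘ fstF) sndF) (sndF ∘ fstF)) (bitK SF fstF))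
/-- On `u`: every syndrome equation holds. [cite: KuoLu2020, §3 (Question «e Λ Hᵀ = s»; chunk p0005 L125–127)] -/
def SY : List Bool → List Bool := allIdxFn (rhatF ∘ fstF) syBit
/-- On `⟨u, 1ᵏ⟩`: `[aₖ ∨ bₖ]`. [cite: KuoLu2020, §2 (gw; chunk p0004 L126–135)] -/
def wtBit : List Bool → List Bool := orFn (bitK fstF sndF) (bitK sndF sndF)
/-- On `u`: the numeral of `gw(a|b)` (sum fold). [cite: AroraBarak2009, §1.3 (bounded loops)] -/
def wtSum : List Bool → List Bool := sndPow 2 ∘ foldLoop addFn wtBit X ∘ spInit fstF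
/-- On `u`: `[gw(e) ≤ t]`. [cite: KuoLu2020, §3 (Question «gw(e) ≤ t»; chunk p0005 L125–127)] -/
def WT : List Bool → List Bool := notFn (ltFn ∘ fanoutFn (sndF ∘ fstF) wtSum)
/-- The certificate branch `R1 ∧ W1 ∧ SO ∧ SY ∧ WT`. [folklore] -/
def branch : List Bool → List Bool := andFn R1 (andFn W1 (andFn SO (andFn SY WT)))
/-- **The verifier** `V = T ∧ (Z0 ∨ (R1 ∧ W1 ∧ SO ∧ SY ∧ WT))` on `u = ⟨x, c⟩`.
[cite: KuoLu2020, §3 Theorem («CGW is NP-complete»; chunk p0005 L129–134); AroraBarak2009, Def. 2.1] -/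
def V : List Bool → List Bool := andFn (T ∘ fstF) (orFn Z0 branch)

/-- `W1 ∈ FP`. [cite: AroraBarak2009, §1.3 (polynomial time is closed under composition)] -/
theorem W1_mem_FP : W1 ∈ FP :=
  andFn_mem_FP (QMinDistNP.lenOk_mem_FP (comp_mem_FP fstF_mem_FP sndF_mem_FP))
    (QMinDistNP.lenOk_mem_FP (comp_mem_FP sndF_mem_FP sndF_mem_FP))
/-- `Z0 ∈ FP`. [cite: AroraBarak2009, §1.3 (polynomial time is closed under composition)] -/
theorem Z0_mem_FP : Z0 ∈ FP :=
  comp_mem_FP eqPairFn_mem_FP (fanoutFn_mem_FP (comp_mem_FP QMinDistNP.rhatF_mem_FP fstF_mem_FP) (const_mem_FP _))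
/-- `R1 ∈ FP`. [cite: AroraBarak2009, §1.3] -/
theorem R1_mem_FP : R1 ∈ FP := notFn_mem_FP Z0_mem_FP
/-- The row accessor of `soBit` (first index) is in `FP`. [cite: AroraBarak2009, §1.3] -/
private theorem rowAcc2i_mem_FP : (itemF ∘ fanoutFn (fstF ∘ fstF ∘ fstF) (sndF ∘ fstF)) ∈ FP :=
  comp_mem_FP itemF_mem_FP (fanoutFn_mem_FP (comp_mem_FP fstF_mem_FP (comp_mem_FP fstF_mem_FP fstF_mem_FP))
    (comp_mem_FP sndF_mem_FP fstF_mem_FP))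
/-- The row accessor of `soBit` (second index) is in `FP`. [cite: AroraBarak2009, §1.3] -/
private theorem rowAcc2j_mem_FP : (itemF ∘ fanoutFn (fstF ∘ fstF ∘ fstF) sndF) ∈ FP :=
  comp_mem_FP itemF_mem_FP (fanoutFn_mem_FP (comp_mem_FP fstF_mem_FP (comp_mem_FP fstF_mem_FP fstF_mem_FP)) sndF_mem_FP)
/-- The row accessor of `syBit` is in `FP`. [cite: AroraBarak2009, §1.3] -/
private theorem rowAcc1_mem_FP : (itemF ∘ fanoutFn (fstF ∘ fstF) sndF) ∈ FP :=
  comp_mem_FP itemF_mem_FP (fanoutFn_mem_FP (comp_mem_FP fstF_mem_FP fstF_mem_FP) sndF_mem_FP)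
/-- `soBit ∈ FP`. [cite: AroraBarak2009, §1.3] -/
theorem soBit_mem_FP : soBit ∈ FP :=
  notFn_mem_FP (QMinDistNP.spPar_mem_FP (comp_mem_FP fstF_mem_FP (comp_mem_FP fstF_mem_FP fstF_mem_FP)) rowAcc2i_mem_FP rowAcc2j_mem_FP)
/-- `soBit` is one-bit. [cite: AroraBarak2009, §1.3] -/
theorem oneBit_soBit : OneBit soBit := oneBit_notFn QMinDistNP.oneBit_spPar
/-- `SO ∈ FP`. [cite: AroraBarak2009, §1.3 (bounded loops)] -/
theorem SO_mem_FP : SO ∈ FP :=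
  allIdxFn_mem_FP (comp_mem_FP QMinDistNP.rhatF_mem_FP fstF_mem_FP)
    (allIdxFn_mem_FP (comp_mem_FP QMinDistNP.rhatF_mem_FP (comp_mem_FP fstF_mem_FP fstF_mem_FP)) soBit_mem_FP oneBit_soBit)
    (oneBit_allIdxFn oneBit_soBit fun u => by
      rw [Function.comp_apply, Function.comp_apply, QMinDistNP.rhatF_apply, List.length_replicate]
      exact (rhat_le _).trans ((length_fstF_le _).trans (length_fstF_le u)))
/-- `syBit ∈ FP`. [cite: AroraBarak2009, §1.3] -/
theorem syBit_mem_FP : syBit ∈ FP :=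
  notFn_mem_FP (xorFn_mem_FP (QMinDistNP.spPar_mem_FP (comp_mem_FP fstF_mem_FP fstF_mem_FP) rowAcc1_mem_FP
      (comp_mem_FP sndF_mem_FP fstF_mem_FP)) (QMinDistNP.bitK_mem_FP SF_mem_FP fstF_mem_FP))
/-- `syBit` is one-bit. [cite: AroraBarak2009, §1.3] -/
theorem oneBit_syBit : OneBit syBit := oneBit_notFn (oneBit_xorFn QMinDistNP.oneBit_spPar (oneBit_headBitFn.comp _))
/-- `SY ∈ FP`. [cite: AroraBarak2009, §1.3 (bounded loops)] -/
theorem SY_mem_FP : SY ∈ FP := allIdxFn_mem_FP (comp_mem_FP QMinDistNP.rhatF_mem_FP fstF_mem_FP) syBit_mem_FP oneBit_syBit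
/-- `wtBit ∈ FP`. [cite: AroraBarak2009, §1.3] -/
theorem wtBit_mem_FP : wtBit ∈ FP :=
  orFn_mem_FP (QMinDistNP.bitK_mem_FP fstF_mem_FP sndF_mem_FP) (QMinDistNP.bitK_mem_FP sndF_mem_FP sndF_mem_FP)
/-- `wtBit` is one-bit. [cite: AroraBarak2009, §1.3] -/
theorem oneBit_wtBit : OneBit wtBit := oneBit_orFn (oneBit_headBitFn.comp _) (oneBit_headBitFn.comp _)
/-- One-bit functions have linear growth. [folklore] -/
private theorem length_le_of_oneBit {f : List Bool → List Bool} (hf : OneBit f) (z : List Bool) :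
    (f z).length ≤ 1 * ((fstF z).length + 1) := by
  rw [hf.length_eq]; omega
/-- `wtSum ∈ FP`. [cite: AroraBarak2009, §1.3 (bounded loops)] -/
theorem wtSum_mem_FP : wtSum ∈ FP :=
  comp_mem_FP (sndPow_mem_FP 2) (comp_mem_FP
    (foldLoop_mem_FP addFn_mem_FP length_addFn_le wtBit_mem_FP (length_le_of_oneBit oneBit_wtBit) X)
    (fanoutFn_mem_FP OracleCompose.id_mem_FP (fanoutFn_mem_FP
      (comp_mem_FP lenBinF_mem_FP (comp_mem_FP QMinDistNP.nhatF_mem_FP fstF_mem_FP)) (const_mem_FP _))))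
/-- `WT ∈ FP`. [cite: AroraBarak2009, §1.3] -/
theorem WT_mem_FP : WT ∈ FP := notFn_mem_FP (comp_mem_FP ltFn_mem_FP (fanoutFn_mem_FP (comp_mem_FP sndF_mem_FP fstF_mem_FP) wtSum_mem_FP))
/-- `branch ∈ FP`. [cite: AroraBarak2009, §1.3] -/
theorem branch_mem_FP : branch ∈ FP :=
  andFn_mem_FP R1_mem_FP (andFn_mem_FP W1_mem_FP (andFn_mem_FP SO_mem_FP (andFn_mem_FP SY_mem_FP WT_mem_FP)))
/-- **`V ∈ FP`.** [cite: AroraBarak2009, §1.3 (polynomial time is closed under composition and bounded loops)] -/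
theorem V_mem_FP : V ∈ FP := andFn_mem_FP (comp_mem_FP T_mem_FP fstF_mem_FP) (orFn_mem_FP Z0_mem_FP branch_mem_FP)

/-- `W1` is one-bit. [cite: AroraBarak2009, §1.3 (polynomial time is closed under composition)] -/
theorem oneBit_W1 : OneBit W1 := oneBit_andFn (oneBit_eqPairFn.comp _) (oneBit_eqPairFn.comp _)
/-- `Z0` is one-bit. [cite: AroraBarak2009, §1.3 (polynomial time is closed under composition)] -/
theorem oneBit_Z0 : OneBit Z0 := oneBit_eqPairFn.comp _
/-- `SO` is one-bit. [cite: AroraBarak2009, §1.3 (polynomial time is closed under composition and bounded loops)] -/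
theorem oneBit_SO : OneBit SO :=
  oneBit_allIdxFn (oneBit_allIdxFn oneBit_soBit fun u => by
      rw [Function.comp_apply, Function.comp_apply, QMinDistNP.rhatF_apply, List.length_replicate]
      exact (rhat_le _).trans ((length_fstF_le _).trans (length_fstF_le u))) fun u => by
    rw [Function.comp_apply, QMinDistNP.rhatF_apply, List.length_replicate]
    exact (rhat_le _).trans (length_fstF_le u)
/-- `SY` is one-bit. [cite: AroraBarak2009, §1.3 (polynomial time is closed under composition and bounded loops)] -/
theorem oneBit_SY : OneBit SY :=
  oneBit_allIdxFn oneBit_syBit fun u => by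
    rw [Function.comp_apply, QMinDistNP.rhatF_apply, List.length_replicate]
    exact (rhat_le _).trans (length_fstF_le u)
/-- `WT` is one-bit. [cite: AroraBarak2009, §1.3 (polynomial time is closed under composition)] -/
theorem oneBit_WT : OneBit WT := oneBit_notFn (oneBit_ltFn.comp _)
/-- `branch` is one-bit. [cite: AroraBarak2009, §1.3 (polynomial time is closed under composition)] -/
theorem oneBit_branch : OneBit branch :=
  oneBit_andFn (oneBit_notFn oneBit_Z0) (oneBit_andFn oneBit_W1 (oneBit_andFn oneBit_SO (oneBit_andFn oneBit_SY oneBit_WT)))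
/-- `V` is one-bit. [cite: AroraBarak2009, §1.3 (polynomial time is closed under composition)] -/
theorem oneBit_V : OneBit V := oneBit_andFn (oneBit_T.comp _) (oneBit_orFn oneBit_Z0 oneBit_branch)

/-! ### Values of the checks -/

section Values

variable (x c : List Bool)

/-- The error's X-part bits `a` in a certificate `c = ⟨a, b⟩` (junk-tolerant). [folklore] -/
def cA (c : List Bool) : List Bool := fstF c
/-- The error's Z-part bits `b`. [folklore] -/
def cB (c : List Bool) : List Bool := sndF c

/-- The verifier's input `u = ⟨x, c⟩`. [folklore] -/
def uRec (x c : List Bool) : List Bool := boolPair x c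

/-- Value of `fstF`. [folklore] -/
private theorem fstF_uRec : fstF (uRec x c) = x := by simp [uRec]
/-- Value of `sndF`. [folklore] -/
private theorem sndF_uRec : sndF (uRec x c) = c := by simp [uRec]

/-- Value of `lenOk` (re-proved; private upstream). [folklore] -/
private theorem lenOk_apply (g : List Bool → List Bool) (u : List Bool) : lenOk g u = [decide ((g u).length = nhat (fstF u))] := by
  rw [QMinDistNP.lenOk, Function.comp_apply, fanoutFn_apply, Function.comp_apply, ThreeDMNP.onesFn_eq_ones, Function.comp_apply,
    QMinDistNP.nhatF_apply, eqPairFn_boolPair, decide_ones_eq_ones]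

/-- Value of `bitK` (re-proved; private upstream). [folklore] -/
private theorem bitK_apply (h g : List Bool → List Bool) (ctx : List Bool) (k : ℕ) :
    bitK h g (boolPair ctx (ones k)) = [(h (g ctx)).getD k false] := by
  simp only [QMinDistNP.bitK, Function.comp_apply, fanoutFn_apply, sndF_boolPair, fstF_boolPair, bitAtFn_boolPair,
    List.length_replicate, headBitFn_apply, ThreeDMNP.headD_take_drop]

/-- A single bit as a numeral. [folklore] -/
private theorem bitsToNat_single (b : Bool) : bitsToNat [b] = b.toNat := by
  rw [bitsToNat_cons, bitsToNat_nil]; omega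

/-- Value of `W1`. [cite: AroraBarak2009, §1.3 (composition of polynomial-time string functions)] -/
theorem W1_apply : W1 (uRec x c) = [decide ((cA c).length = nhat x) && decide ((cB c).length = nhat x)] := by
  rw [W1, andFn_apply (lenOk_apply _ _) (lenOk_apply _ _)]
  simp only [Function.comp_apply, sndF_uRec, fstF_uRec]
  rfl

/-- Value of `Z0`: the row-free test `m = 0`. [cite: AroraBarak2009, §1.3] -/
theorem Z0_apply : Z0 (uRec x c) = [decide (rhat x = 0)] := by
  rw [Z0, Function.comp_apply, fanoutFn_apply, Function.comp_apply, fstF_uRec, QMinDistNP.rhatF_apply, eqPairFn_boolPair,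
    decide_ones_eq_nil]

/-- Value of `R1`. [cite: AroraBarak2009, §1.3] -/
theorem R1_apply : R1 (uRec x c) = [!decide (rhat x = 0)] := by
  rw [R1, notFn_apply (Z0_apply x c)]

/-- The context of the loops is no shorter than the input. [folklore] -/
private theorem nhat_le_uRec : nhat x ≤ (uRec x c).length := by
  rw [uRec, length_boolPair]; have := nhat_le x; omega

/-- Value of `soBit`. [folklore] -/
private theorem soBit_apply (i j : ℕ) :
    soBit (boolPair (boolPair (uRec x c) (ones i)) (ones j)) =
      [!decide (spNat (aIt x i) (bIt x i) (aIt x j) (bIt x j) (nhat x) % 2 = 1)] := by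
  rw [soBit, notFn_apply (QMinDistNP.spPar_apply _ (by
    simp only [Function.comp_apply, fstF_boolPair, fstF_uRec, length_boolPair]
    have := nhat_le_uRec x c
    omega))]
  simp only [Function.comp_apply, fanoutFn_apply, fstF_boolPair, sndF_boolPair, fstF_uRec, itemF_apply, aIt, bIt]
  rfl

/-- Value of `SO`: all pairs of rows have even symplectic pairing. [cite: KuoLu2020, §3 (Input «HΛHᵀ = O»); AroraBarak2009, §1.3 (bounded loops)] -/
theorem SO_apply : SO (uRec x c) =
    [decide (∀ i < rhat x, ∀ j < rhat x, decide (spNat (aIt x i) (bIt x i) (aIt x j) (bIt x j) (nhat x) % 2 = 1) = false)] := by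
  have hin : ∀ i, allIdxFn (rhatF ∘ fstF ∘ fstF) soBit (boolPair (uRec x c) (ones i)) =
      [decide (∀ j < rhat x, decide (spNat (aIt x i) (bIt x i) (aIt x j) (bIt x j) (nhat x) % 2 = 1) = false)] := fun i => by
    rw [allIdxFn_apply oneBit_soBit (h := rhatF ∘ fstF ∘ fstF)
      (by rw [Function.comp_apply, Function.comp_apply, fstF_boolPair, fstF_uRec, QMinDistNP.rhatF_apply, List.length_replicate,
            length_boolPair, uRec, length_boolPair]; have := rhat_le x; omega)]
    simp only [Function.comp_apply, fstF_boolPair, fstF_uRec, QMinDistNP.rhatF_apply, List.length_replicate, soBit_apply]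
    simp
  rw [SO, allIdxFn_apply (oneBit_allIdxFn oneBit_soBit fun u => by
      rw [Function.comp_apply, Function.comp_apply, QMinDistNP.rhatF_apply, List.length_replicate]
      exact (rhat_le _).trans ((length_fstF_le _).trans (length_fstF_le u))) (h := rhatF ∘ fstF)
    (by rw [Function.comp_apply, fstF_uRec, QMinDistNP.rhatF_apply, List.length_replicate, uRec, length_boolPair]; have := rhat_le x; omega)]
  simp only [Function.comp_apply, fstF_uRec, QMinDistNP.rhatF_apply, List.length_replicate, hin]
  simp

/-- Value of `syBit`: `[(row i, e) ≡ sᵢ]`. [cite: KuoLu2020, §3 (Question «e Λ Hᵀ = s»; chunk p0005 L125–127)] -/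
private theorem syBit_apply (i : ℕ) :
    syBit (boolPair (uRec x c) (ones i)) =
      [!(xor (decide (spNat (aIt x i) (bIt x i) (cA c) (cB c) (nhat x) % 2 = 1)) ((SOf x).getD i false))] := by
  have h1 : spPar (fstF ∘ fstF) (itemF ∘ fanoutFn (fstF ∘ fstF) sndF) (sndF ∘ fstF) (boolPair (uRec x c) (ones i)) =
      [decide (spNat (aIt x i) (bIt x i) (cA c) (cB c) (nhat x) % 2 = 1)] := by
    rw [QMinDistNP.spPar_apply _ (by
      simp only [Function.comp_apply, fstF_boolPair, fstF_uRec, length_boolPair]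
      have := nhat_le_uRec x c
      omega)]
    simp only [Function.comp_apply, fanoutFn_apply, fstF_boolPair, sndF_boolPair, fstF_uRec, sndF_uRec, itemF_apply, aIt, bIt]
    rfl
  have h2 : bitK SF fstF (boolPair (uRec x c) (ones i)) = [(SOf x).getD i false] := by
    rw [bitK_apply, fstF_uRec, SF_apply]
  rw [syBit, notFn_apply (xorFn_apply h1 h2)]

/-- Value of `SY`: every syndrome equation holds. [cite: KuoLu2020, §3 (Question «e Λ Hᵀ = s»); AroraBarak2009, §1.3 (bounded loops)] -/
theorem SY_apply : SY (uRec x c) =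
    [decide (∀ i < rhat x, decide (spNat (aIt x i) (bIt x i) (cA c) (cB c) (nhat x) % 2 = 1) = (SOf x).getD i false)] := by
  rw [SY, allIdxFn_apply oneBit_syBit (h := rhatF ∘ fstF)
    (by rw [Function.comp_apply, fstF_uRec, QMinDistNP.rhatF_apply, List.length_replicate, uRec, length_boolPair]; have := rhat_le x; omega)]
  simp only [Function.comp_apply, fstF_uRec, QMinDistNP.rhatF_apply, List.length_replicate, syBit_apply]
  congr 2
  refine propext (forall_congr' fun i => forall_congr' fun _ => ?_)
  cases decide (spNat (aIt x i) (bIt x i) (cA c) (cB c) (nhat x) % 2 = 1) <;> cases (SOf x).getD i false <;> simp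

/-- Value of `wtBit`. [folklore] -/
private theorem wtBit_apply (k : ℕ) : wtBit (boolPair (uRec x c) (ones k)) = [(cA c).getD k false || (cB c).getD k false] := by
  rw [wtBit, orFn_apply (bitK_apply _ _ _ k) (bitK_apply _ _ _ k), sndF_uRec]
  rfl

/-- Value of `wtSum`. [folklore] -/
private theorem wtSum_apply : wtSum (uRec x c) = encodeNat (wtNat (cA c) (cB c) (nhat x)) := by
  have hinit : spInit fstF (uRec x c) =
      boolPair (uRec x c) (boolPair (encodeNat (nhat x)) (boolPair (ones 0) (encodeNat 0))) := by
    simp only [QMinDistNP.spInit, fanoutFn_apply, id, Function.comp_apply, fstF_uRec, QMinDistNP.nhatF_apply, lenBinF_apply,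
      List.length_replicate]; rfl
  have hk : nhat x ≤ (X : Polynomial ℕ).eval (uRec x c).length := by rw [eval_X]; exact nhat_le_uRec x c
  rw [wtSum, Function.comp_apply, Function.comp_apply, hinit, foldLoop_apply addFn wtBit hk 0 (encodeNat 0), foldAcc_addFn]
  simp only [sndPow, Function.comp_apply, sndF_boolPair, Nat.zero_add, wtBit_apply, bitsToNat_single, QMinDistNP.wtNat]

/-- Value of `WT`: `[gw(a|b) ≤ t]`. [cite: KuoLu2020, §3 (Question «gw(e) ≤ t»); AroraBarak2009, §1.3 (bounded loops)] -/
theorem WT_apply : WT (uRec x c) = [!decide (tOf x < wtNat (cA c) (cB c) (nhat x))] := by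
  rw [WT, notFn_apply]
  rw [Function.comp_apply, fanoutFn_apply, Function.comp_apply, fstF_uRec, wtSum_apply, ltFn_boolPair, bitsToNat_encodeNat]; rfl

/-- **Value of the verifier.** [cite: KuoLu2020, §3 Theorem («CGW is NP-complete»); AroraBarak2009, Def. 2.1] -/
theorem V_eq_true_iff : V (uRec x c) = [true] ↔
    GoodShape x ∧ (rhat x = 0 ∨
      (rhat x ≠ 0 ∧ ((cA c).length = nhat x ∧ (cB c).length = nhat x) ∧
        (∀ i < rhat x, ∀ j < rhat x, decide (spNat (aIt x i) (bIt x i) (aIt x j) (bIt x j) (nhat x) % 2 = 1) = false) ∧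
        (∀ i < rhat x, decide (spNat (aIt x i) (bIt x i) (cA c) (cB c) (nhat x) % 2 = 1) = (SOf x).getD i false) ∧
        wtNat (cA c) (cB c) (nhat x) ≤ tOf x)) := by
  rw [V, andFn_eq_true_iff (oneBit_T.comp fstF) (oneBit_orFn oneBit_Z0 oneBit_branch), Function.comp_apply,
    show fstF (uRec x c) = x from fstF_uRec x c, T_eq_true_iff,
    orFn_eq_true_iff oneBit_Z0 oneBit_branch, Z0_apply, branch,
    andFn_apply (R1_apply x c) (andFn_apply (W1_apply x c) (andFn_apply (SO_apply x c)
      (andFn_apply (SY_apply x c) (WT_apply x c))))]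
  simp only [List.cons.injEq, and_true, Bool.and_eq_true, Bool.not_eq_true', decide_eq_false_iff_not, not_lt,
    decide_eq_true_eq]

end Values

/-! ### Soundness and completeness -/

/-- Reading a structured certificate. [folklore] -/
private theorem cA_pair (a b : List Bool) : cA (boolPair a b) = a := fstF_boolPair a b
/-- Reading a structured certificate. [folklore] -/
private theorem cB_pair (a b : List Bool) : cB (boolPair a b) = b := sndF_boolPair a b

/-- **Soundness**: an accepted pair `⟨x, c⟩` has `x ∈ CGW`. In the row-free case the error `0` has the
(empty) syndrome and weight `0`; otherwise the rows pairwise commute and the error `e = (a|b)` read off the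
certificate has syndrome `s` and weight `≤ t`. [cite: KuoLu2020, §3 Theorem («CGW is NP-complete»; chunk p0005 L129–134)] -/
theorem mem_of_accepts {x c : List Bool} (h : V (boolPair x c) = [true]) : x ∈ CGW := by
  obtain ⟨hG, hcase⟩ := (V_eq_true_iff x c).1 h
  obtain ⟨hr, hn⟩ := clamps_of_goodShape hG
  rw [← encode_instOf hG, CGW, Computability.Encoding.mem_toLanguage_iff]
  show IsSelfOrthogonal (rowSpan (rowsOf x)) ∧
    ∃ e : SympVec (nOf x), sympSyndrome (rowsOf x) e = sVecOf x ∧ sympWeight e ≤ tOf x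
  rcases hcase with hr0 | ⟨hr0, -, hSO, hSY, hWT⟩
  · have h00 : rOf x = 0 := by rw [← hr]; exact hr0
    haveI : IsEmpty (Fin (rOf x)) := ⟨fun i => absurd i.2 (by omega)⟩
    have hbot : rowSpan (rowsOf x) = ⊥ := by rw [rowSpan, Set.range_eq_empty, Submodule.span_empty]
    refine ⟨?_, 0, funext fun i => isEmptyElim i, ?_⟩
    · rw [hbot]
      show (⊥ : Submodule (ZMod 2) (SympVec (nOf x))) ≤ sympDual ⊥
      exact bot_le
    rw [(sympWeight_eq_zero_iff (0 : SympVec (nOf x))).2 rfl]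
    exact Nat.zero_le _
  · have hnn : nhat x = nOf x := hn (Nat.pos_of_ne_zero hr0)
    rw [hnn] at hSO hSY hWT
    rw [hr] at hSO hSY
    refine ⟨(isSelfOrthogonal_span_range_iff (rowsOf x)).2 fun i j =>
        (QMinDistNP.sympInner_svecOf_eq_zero_iff _ _ _ _ _).2 (hSO i i.2 j j.2),
      svecOf (nOf x) (cA c) (cB c), funext fun i => ?_, by rw [← QMinDistNP.wtNat_eq_sympWeight]; exact hWT⟩
    rw [sympSyndrome_apply, rowsOf, sVecOf, QMinDistNP.vecOf]
    exact (sympInner_svecOf_eq_bit_iff _ _ _ _ _ _).2 (hSY i i.2)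

/-- **Completeness**: a yes-instance has a short accepted certificate — empty in the row-free case, else the
bits `⟨a, b⟩` of an error `e = (a|b)` with syndrome `s` and `gw(e) ≤ t`; length `3n + 2 ≤ 3|x| + 2`.
[cite: KuoLu2020, §3 Theorem («CGW is NP-complete»; chunk p0005 L129–134); AroraBarak2009, Def. 2.1] -/
theorem accepts_of_mem (I : (Σ m : ℕ, Σ n : ℕ, (Fin m → SympVec n) × (Fin m → ZMod 2)) × ℕ)
    (hI : I ∈ cosetGeneralizedWeightsSet) :
    ∃ c : List Bool, c.length ≤ 3 * ((encodingSyndInstance.pairBool encodingNatBool).encode I).length + 2 ∧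
      V (boolPair ((encodingSyndInstance.pairBool encodingNatBool).encode I) c) = [true] := by
  obtain ⟨hso, e, he, het⟩ := hI
  obtain ⟨hrh, hnh⟩ := clamps_encode I
  obtain ⟨-, -, h3, -, -⟩ := fields_encode I
  rcases Nat.eq_zero_or_pos I.1.1 with hr | hr
  · refine ⟨[], by simp, ?_⟩
    show V (uRec _ _) = [true]
    rw [V_eq_true_iff, hrh]
    exact ⟨goodShape_encode I, Or.inl hr⟩
  · refine ⟨boolPair (bitsOf e.1) (bitsOf e.2), ?_, ?_⟩
    · have hnl := n_le_length_encode I hr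
      simp only [length_boolPair, QMinDistNP.length_bitsOf]
      omega
    · show V (uRec _ _) = [true]
      rw [V_eq_true_iff, hrh, hnh hr, h3, cA_pair, cB_pair]
      refine ⟨goodShape_encode I, Or.inr ⟨hr.ne', ⟨QMinDistNP.length_bitsOf _, QMinDistNP.length_bitsOf _⟩,
        fun i hi j hj => ?_, fun i hi => ?_, ?_⟩⟩
      · rw [← QMinDistNP.sympInner_svecOf_eq_zero_iff, svecOf_aIt_bIt I ⟨i, hi⟩, svecOf_aIt_bIt I ⟨j, hj⟩]
        exact (isSelfOrthogonal_span_range_iff I.1.2.2.1).1 hso ⟨i, hi⟩ ⟨j, hj⟩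
      · rw [getD_SOf_encode I ⟨i, hi⟩, ← sympInner_svecOf_eq_bit_iff, svecOf_aIt_bIt I ⟨i, hi⟩, QMinDistNP.svecOf_bitsOf,
          ← sympSyndrome_apply I.1.2.2.1 e, he]
        rcases zmod2_cases (I.1.2.2.2 ⟨i, hi⟩) with h0 | h1
        · rw [h0]; decide
        · rw [h1]; decide
      · rw [QMinDistNP.wtNat_eq_sympWeight, QMinDistNP.svecOf_bitsOf]
        exact het

/-! ### `CGW ∈ NP`, `CGW_Z ∈ NP` -/

/-- The verifier's language. [cite: AroraBarak2009, Def. 2.1] -/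
def Rlang : Language Bool := {u | V u = [true]}

/-- **`Rlang ∈ P`.** [cite: AroraBarak2009, Def. 1.13] -/
theorem Rlang_mem_P : Rlang ∈ Classes.P :=
  mem_P_of_mem_FP V_mem_FP _ fun u =>
    ⟨fun h => h, fun h => by
      obtain ⟨b, hb⟩ := oneBit_V u
      cases b
      · exact hb
      · exact absurd hb h⟩

/-- **COSET GENERALIZED WEIGHTS is in `NP`**: guess an error `e = (a|b)`; the verifier `V` checks in
polynomial time that the input codes an instance, that the rows commute, that `e Λ Hᵀ = s` and `gw(e) ≤ t`;
certificate length `≤ 3|x| + 2`. [cite: KuoLu2020, §3 Theorem («CGW is NP-complete»; chunk p0005 L129–134); AroraBarak2009, Def. 2.1] -/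
theorem CGW_mem_NP : CGW ∈ Nondeterministic.NP := by
  refine ⟨Rlang, Rlang_mem_P, 3 * X + 2, fun x => ⟨?_, ?_⟩⟩
  · rintro ⟨I, hI, rfl⟩
    obtain ⟨c, hc, hV⟩ := accepts_of_mem I hI
    exact ⟨c, by simp only [eval_add, eval_mul, eval_ofNat, eval_X]; exact hc, hV⟩
  · rintro ⟨c, -, hc⟩
    exact mem_of_accepts hc

/-! ### The Z-type test and `CGW_Z ∈ NP` -/

/-- On `⟨⟨u, 1ⁱ⟩, 1ᵏ⟩`: `[bit k of aᵢ is 0]`. [cite: KuoLu2020, §3 (CGW_Z: H = [O|H_Z]; chunk p0005 L135–141)] -/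
def zBit : List Bool → List Bool := notFn (bitK fstF (itemF ∘ fanoutFn (fstF ∘ fstF) sndF))
/-- On `u`: every row is Z-type (`aᵢ = 0ⁿ` for all `i < m`). [cite: KuoLu2020, §3 (CGW_Z; chunk p0005 L135–141)] -/
def ZR : List Bool → List Bool := allIdxFn (rhatF ∘ fstF) (allIdxFn (nhatF ∘ fstF ∘ fstF) zBit)
/-- **The verifier for `CGW_Z`**: `V ∧ ZR`. [cite: KuoLu2020, §3 Theorem (clause «even if H = [O|H_Z]»; chunk p0005 L129–134)] -/
def VZ : List Bool → List Bool := andFn V ZR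

/-- `zBit ∈ FP`. [cite: AroraBarak2009, §1.3] -/
theorem zBit_mem_FP : zBit ∈ FP := notFn_mem_FP (QMinDistNP.bitK_mem_FP fstF_mem_FP rowAcc1_mem_FP)
/-- `zBit` is one-bit. [cite: AroraBarak2009, §1.3] -/
theorem oneBit_zBit : OneBit zBit := oneBit_notFn (oneBit_headBitFn.comp _)
/-- The inner Z-type loop is one-bit. [folklore] -/
private theorem oneBit_ZRin : OneBit (allIdxFn (nhatF ∘ fstF ∘ fstF) zBit) :=
  oneBit_allIdxFn oneBit_zBit fun u => by
    rw [Function.comp_apply, Function.comp_apply, QMinDistNP.nhatF_apply, List.length_replicate]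
    exact (nhat_le _).trans ((length_fstF_le _).trans (length_fstF_le u))
/-- `ZR ∈ FP`. [cite: AroraBarak2009, §1.3 (bounded loops)] -/
theorem ZR_mem_FP : ZR ∈ FP :=
  allIdxFn_mem_FP (comp_mem_FP QMinDistNP.rhatF_mem_FP fstF_mem_FP)
    (allIdxFn_mem_FP (comp_mem_FP QMinDistNP.nhatF_mem_FP (comp_mem_FP fstF_mem_FP fstF_mem_FP)) zBit_mem_FP oneBit_zBit)
    oneBit_ZRin
/-- `ZR` is one-bit. [cite: AroraBarak2009, §1.3 (polynomial time is closed under composition and bounded loops)] -/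
theorem oneBit_ZR : OneBit ZR :=
  oneBit_allIdxFn oneBit_ZRin fun u => by
    rw [Function.comp_apply, QMinDistNP.rhatF_apply, List.length_replicate]
    exact (rhat_le _).trans (length_fstF_le u)
/-- **`VZ ∈ FP`.** [cite: AroraBarak2009, §1.3] -/
theorem VZ_mem_FP : VZ ∈ FP := andFn_mem_FP V_mem_FP ZR_mem_FP
/-- `VZ` is one-bit. [cite: AroraBarak2009, §1.3 (polynomial time is closed under composition)] -/
theorem oneBit_VZ : OneBit VZ := oneBit_andFn oneBit_V oneBit_ZR

/-- Value of `zBit`. [folklore] -/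
private theorem zBit_apply (x c : List Bool) (i k : ℕ) :
    zBit (boolPair (boolPair (uRec x c) (ones i)) (ones k)) = [!(aIt x i).getD k false] := by
  rw [zBit, notFn_apply (bitK_apply _ _ _ k)]
  simp only [Function.comp_apply, fanoutFn_apply, fstF_boolPair, sndF_boolPair, uRec, itemF_apply, aIt]

/-- Value of `ZR`: every X-part bit of every row vanishes. [cite: KuoLu2020, §3 (CGW_Z; chunk p0005 L135–141)] -/
theorem ZR_apply (x c : List Bool) : ZR (uRec x c) = [decide (∀ i < rhat x, ∀ k < nhat x, (aIt x i).getD k false = false)] := by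
  have hin : ∀ i, allIdxFn (nhatF ∘ fstF ∘ fstF) zBit (boolPair (uRec x c) (ones i)) =
      [decide (∀ k < nhat x, (aIt x i).getD k false = false)] := fun i => by
    rw [allIdxFn_apply oneBit_zBit (h := nhatF ∘ fstF ∘ fstF)
      (by rw [Function.comp_apply, Function.comp_apply, fstF_boolPair, show fstF (uRec x c) = x by simp [uRec],
            QMinDistNP.nhatF_apply, List.length_replicate, length_boolPair, uRec, length_boolPair]; have := nhat_le x; omega)]
    simp only [Function.comp_apply, fstF_boolPair, show fstF (uRec x c) = x by simp [uRec], QMinDistNP.nhatF_apply,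
      List.length_replicate, zBit_apply]
    simp
  rw [ZR, allIdxFn_apply oneBit_ZRin (h := rhatF ∘ fstF)
    (by rw [Function.comp_apply, show fstF (uRec x c) = x by simp [uRec], QMinDistNP.rhatF_apply, List.length_replicate, uRec,
          length_boolPair]; have := rhat_le x; omega)]
  simp only [Function.comp_apply, show fstF (uRec x c) = x by simp [uRec], QMinDistNP.rhatF_apply, List.length_replicate, hin]
  simp

/-- A bit table with no set bit below `K` reads as the zero vector. [folklore] -/
private theorem vecOf_eq_zero {K : ℕ} {l : List Bool} (h : ∀ k < K, l.getD k false = false) : vecOf K l = 0 := by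
  funext k
  rw [QMinDistNP.vecOf, h k k.2]
  rfl

/-- **Soundness for `CGW_Z`**: an accepted pair has `x ∈ CGW_Z`. [cite: KuoLu2020, §3 Theorem (clause «even if H = [O|H_Z]»)] -/
theorem memZ_of_accepts {x c : List Bool} (h : VZ (boolPair x c) = [true]) : x ∈ CGWZ := by
  rw [VZ, andFn_eq_true_iff oneBit_V oneBit_ZR] at h
  obtain ⟨hV, hZ⟩ := h
  have hx : x ∈ CGW := mem_of_accepts hV
  obtain ⟨hG, -⟩ := (V_eq_true_iff x c).1 hV
  obtain ⟨hr, hn⟩ := clamps_of_goodShape hG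
  rw [← encode_instOf hG, CGW, Computability.Encoding.mem_toLanguage_iff] at hx
  rw [← encode_instOf hG, CGWZ, Computability.Encoding.mem_toLanguage_iff]
  refine ⟨fun i => ?_, hx⟩
  have hZ' := hZ
  rw [show boolPair x c = uRec x c from rfl, ZR_apply] at hZ'
  simp only [List.cons.injEq, and_true, decide_eq_true_eq] at hZ'
  have hi : (i : ℕ) < rhat x := by rw [hr]; exact i.2
  show vecOf (nOf x) (aIt x i) = 0
  rw [← hn (by omega)]
  exact vecOf_eq_zero (hZ' i hi)

/-- **Completeness for `CGW_Z`.** [cite: KuoLu2020, §3 Theorem (clause «even if H = [O|H_Z]»); AroraBarak2009, Def. 2.1] -/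
theorem acceptsZ_of_mem (I : (Σ m : ℕ, Σ n : ℕ, (Fin m → SympVec n) × (Fin m → ZMod 2)) × ℕ)
    (hI : I ∈ cosetGeneralizedWeightsZSet) :
    ∃ c : List Bool, c.length ≤ 3 * ((encodingSyndInstance.pairBool encodingNatBool).encode I).length + 2 ∧
      VZ (boolPair ((encodingSyndInstance.pairBool encodingNatBool).encode I) c) = [true] := by
  obtain ⟨hz, hmem⟩ := hI
  obtain ⟨c, hc, hV⟩ := accepts_of_mem I hmem
  refine ⟨c, hc, ?_⟩
  rw [VZ, andFn_eq_true_iff oneBit_V oneBit_ZR]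
  refine ⟨hV, ?_⟩
  obtain ⟨hrh, hnh⟩ := clamps_encode I
  rw [show boolPair _ c = uRec _ c from rfl, ZR_apply, hrh]
  simp only [List.cons.injEq, and_true, decide_eq_true_eq]
  intro i hi k hk
  rw [hnh (by omega)] at hk
  rw [aIt, item_encode, rowCode_of_lt I ⟨i, hi⟩, fstF_boolPair, QMinDistNP.encode_eq_bitsOf, hz ⟨i, hi⟩, QMinDistNP.bitsOf,
    List.getD_eq_getElem _ _ (by simpa using hk), List.getElem_ofFn]
  rfl

/-- The `CGW_Z` verifier's language. [cite: AroraBarak2009, Def. 2.1] -/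
def RlangZ : Language Bool := {u | VZ u = [true]}

/-- **`RlangZ ∈ P`.** [cite: AroraBarak2009, Def. 1.13] -/
theorem RlangZ_mem_P : RlangZ ∈ Classes.P :=
  mem_P_of_mem_FP VZ_mem_FP _ fun u =>
    ⟨fun h => h, fun h => by
      obtain ⟨b, hb⟩ := oneBit_VZ u
      cases b
      · exact hb
      · exact absurd hb h⟩

/-- **`CGW_Z ∈ NP`** (the verifier of `CGW` plus the Z-type test). [cite: KuoLu2020, §3 Theorem (clause «even if H = [O|H_Z]»); AroraBarak2009, Def. 2.1] -/
theorem CGWZ_mem_NP : CGWZ ∈ Nondeterministic.NP := by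
  refine ⟨RlangZ, RlangZ_mem_P, 3 * X + 2, fun x => ⟨?_, ?_⟩⟩
  · rintro ⟨I, hI, rfl⟩
    obtain ⟨c, hc, hV⟩ := acceptsZ_of_mem I hI
    exact ⟨c, by simp only [eval_add, eval_mul, eval_ofNat, eval_X]; exact hc, hV⟩
  · rintro ⟨c, -, hc⟩
    exact memZ_of_accepts hc

end SynDecNP

/-- **Kuo–Lu 2020 §3 Theorem / Fujita 2012 Lemma 2, as printed: COSET GENERALIZED WEIGHTS is NP-complete** —
«CGW is NP-complete»: `CGW ∈ NP` (`SynDecNP.CGW_mem_NP`) and `CGW` is NP-hard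
(`KuoLu2020_cosetGeneralizedWeights_isNPHard`, `SyndromeDecodingHardness.lean`, by `COSETWEIGHTS ≤ₚ CGW`).
I.e. quantum bounded-distance (minimum-weight) syndrome decoding of a stabilizer code from its check matrix
is NP-complete. [cite: KuoLu2020, §3 Theorem «CGW is NP-complete, even if H = [H_X|O] or H = [O|H_Z]» (arXiv:1306.5173 chunk p0005 L129–134), restating Fujita2012 Lemma 2] -/
theorem KuoLu2020_cosetGeneralizedWeights_isNPComplete : IsNPComplete CGW :=
  ⟨SynDecNP.CGW_mem_NP, KuoLu2020_cosetGeneralizedWeights_isNPHard⟩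

/-- **Kuo–Lu 2020 §3 Theorem / Fujita 2012 Lemma 2 with its clause «even if H = [O|H_Z]»: `CGW_Z` is
NP-complete** — bounded-distance syndrome decoding is NP-complete already for Z-type check matrices
(`SynDecNP.CGWZ_mem_NP` and `KuoLu2020_cosetGeneralizedWeightsZ_isNPHard`). [cite: KuoLu2020, §3 Theorem «CGW is NP-complete, even if H = [H_X|O] or H = [O|H_Z]» (arXiv:1306.5173 chunk p0005 L129–134), restating Fujita2012 Lemma 2] -/
theorem KuoLu2020_cosetGeneralizedWeightsZ_isNPComplete : IsNPComplete CGWZ :=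
  ⟨SynDecNP.CGWZ_mem_NP, KuoLu2020_cosetGeneralizedWeightsZ_isNPHard⟩

end Literature.InformationTheory.QuantumCodes

end
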